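import Literature.Barriers.NavierStokesRegularity.NavierStokesInequalityGluing
import HarnessLib

/-!
# Gluing along switching times: time integrals, space–time measurability and lower integrals

Barrier-catalogue support file for `NavierStokesRegularity` (D-0021), serving the discharge of
Scheffer's switching argument (`NSISwitching`; Scheffer 1985, Lemma 2.3; W. S. Ożański,
arXiv:1709.00602, §2). It complements the accepted `NavierStokesInequalityGluing.lean`
(partition of `[0,T₀)` by switching times `0 = t₀ < t₁ < ⋯ ↑ T₀`, strips, weak gradient and weak
divergence of glued fields) with the measure theory of the summation over the pieces that
Ożański performs on p. 7 (`∫₀^∞ ‖∇𝔲‖² = Σⱼ ∫_{t_j}^{t_{j+1}} ‖∇u^{(j)}‖²`, "global-in-time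
integrability of all the terms", "the Dominated Convergence Theorem lets us take the limit
`S' → T₀`") and Scheffer in (2.32)–(2.34):

* `integrable_and_hasSum_of_glue` — **time integrals of glued functions**: if `F = F_j` on
  `[t_j, t_{j+1})`, `F = 0` off `[0, T₀)`, each `F_j` is integrable on its interval and
  `Σⱼ ∫_{[t_j,t_{j+1})} ‖F_j‖ < ∞`, then `F` is integrable on `ℝ` and `∫ F = Σⱼ ∫_{[t_j,t_{j+1})} F_j`;
  `summable_integral_norm_of_geometric` feeds its summability hypothesis from geometric bounds;
* `aestronglyMeasurable_glue` — a field that is continuous on each closed slab `[t_j,t_{j+1}] × E`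
  and vanishes from `T₀` on is a.e. strongly measurable on `(0,∞) × E`;
* `setLIntegral_Ioi_prod_le_tsum` — `∫∫_{(0,∞)×E} W ≤ Σⱼ ∫∫_{[t_j,t_{j+1})×E} W` for `W ≥ 0`
  vanishing from `T₀` on; `setLIntegral_Ico_prod_eq_Ioo_prod`,
  `setLIntegral_Ioo_prod_eq_lintegral_lintegral` (Tonelli on a strip).

## References

* W. S. Ożański, *On weak solutions to the Navier–Stokes inequality with internal
  singularities*, arXiv:1709.00602 (2017), §2, p. 7. [`Ozanski2017NSISingular`]
* V. Scheffer, Comm. Math. Phys. 101 (1985), proof of Lemma 2.3, (2.32)–(2.34). [`Scheffer1985`]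
-/

noncomputable section

open MeasureTheory Set Function Filter Topology

namespace Literature.Barriers.NavierStokesRegularity

/-! ### Time integrals of glued functions -/

section Time

variable {G : Type*} [NormedAddCommGroup G] [NormedSpace ℝ G]
variable {t : ℕ → ℝ} {T₀ : ℝ} {F : ℝ → G} {Fj : ℕ → ℝ → G}

/-- **Time integrals of glued functions.** Let `t_j` be strictly increasing switching times
with `t_0 = 0`, `t_j → T₀`, and let `F` agree with `F_j` on `[t_j, t_{j+1})` and vanish off
`[0, T₀)`. If each `F_j` is integrable on its interval and `Σⱼ ∫_{[t_j,t_{j+1})} ‖F_j‖ < ∞`, then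
`F` is integrable on `ℝ` and `∫ F = Σⱼ ∫_{[t_j,t_{j+1})} F_j` (Ożański 2017, p. 7:
`∫₀^∞ ‖∇𝔲‖² = Σⱼ ∫_{t_j}^{t_{j+1}} ‖∇u^{(j)}‖²`, and the passage to the limit `S' → T₀` in the
local energy inequality; Scheffer 1985, summation of (2.32) over `j`).
[cite: Ozanski2017NSISingular, §2 p. 7] -/
theorem integrable_and_hasSum_of_glue (h0 : t 0 = 0) (hmono : StrictMono t)
    (htend : Tendsto t atTop (𝓝 T₀))
    (heq : ∀ j, EqOn F (Fj j) (Ico (t j) (t (j + 1))))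
    (hzero : ∀ s, s ∉ Ico 0 T₀ → F s = 0)
    (hint : ∀ j, IntegrableOn (Fj j) (Ico (t j) (t (j + 1))))
    (hsum : Summable fun j => ∫ s in Ico (t j) (t (j + 1)), ‖Fj j s‖) :
    Integrable F ∧ HasSum (fun j => ∫ s in Ico (t j) (t (j + 1)), Fj j s) (∫ s, F s) := by
  have hm : ∀ j, MeasurableSet (Ico (t j) (t (j + 1))) := fun j => measurableSet_Ico
  have hFint : ∀ j, IntegrableOn F (Ico (t j) (t (j + 1))) := fun j =>
    (hint j).congr_fun (heq j).symm (hm j)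
  have hnorm : ∀ j, ∫ s in Ico (t j) (t (j + 1)), ‖F s‖ = ∫ s in Ico (t j) (t (j + 1)), ‖Fj j s‖ :=
    fun j => setIntegral_congr_fun (hm j) fun s hs => by rw [heq j hs]
  have hval : ∀ j, ∫ s in Ico (t j) (t (j + 1)), F s = ∫ s in Ico (t j) (t (j + 1)), Fj j s :=
    fun j => setIntegral_congr_fun (hm j) fun s hs => by rw [heq j hs]
  have hU : IntegrableOn F (⋃ j, Ico (t j) (t (j + 1))) :=
    integrableOn_iUnion_of_summable_integral_norm hFint (hsum.congr fun j => (hnorm j).symm)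
  have hsumF := hasSum_integral_iUnion hm (pairwise_disjoint_Ico_of_strictMono hmono) hU
  rw [iUnion_Ico_eq_of_strictMono_tendsto hmono htend, h0] at hU hsumF
  refine ⟨hU.integrable_of_forall_notMem_eq_zero hzero, ?_⟩
  rw [setIntegral_eq_integral_of_forall_compl_eq_zero fun s hs => hzero s hs] at hsumF
  simpa only [hval] using hsumF

omit [NormedSpace ℝ G] in
/-- **Geometric bounds give the summability hypothesis**: if `‖F_j‖ ≤ g_j` on `[t_j, t_{j+1})`
with `∫_{[t_j,t_{j+1})} g_j ≤ C θʲ`, `0 ≤ θ < 1`, then `Σⱼ ∫_{[t_j,t_{j+1})} ‖F_j‖ < ∞` (the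
bounds `τʲ` of Ożański 2017, p. 7 / Scheffer 1985, (2.34)). [cite: Ozanski2017NSISingular, §2 p. 7] -/
theorem summable_integral_norm_of_geometric {g : ℕ → ℝ → ℝ} {C θ : ℝ} (hθ0 : 0 ≤ θ)
    (hθ1 : θ < 1) (hint : ∀ j, IntegrableOn (Fj j) (Ico (t j) (t (j + 1))))
    (hgint : ∀ j, IntegrableOn (g j) (Ico (t j) (t (j + 1))))
    (hle : ∀ j, ∀ s ∈ Ico (t j) (t (j + 1)), ‖Fj j s‖ ≤ g j s)
    (hbound : ∀ j, ∫ s in Ico (t j) (t (j + 1)), g j s ≤ C * θ ^ j) :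
    Summable fun j => ∫ s in Ico (t j) (t (j + 1)), ‖Fj j s‖ := by
  refine Summable.of_nonneg_of_le (fun j => integral_nonneg fun s => norm_nonneg _) (fun j => ?_)
    ((summable_geometric_of_lt_one hθ0 hθ1).mul_left C)
  refine le_trans ?_ (hbound j)
  exact setIntegral_mono_on (hint j).norm (hgint j) measurableSet_Ico (hle j)

end Time

/-! ### Space–time measurability and lower integrals of glued fields -/

section SpaceTime

variable {E : Type*} [NormedAddCommGroup E] [InnerProductSpace ℝ E] [FiniteDimensional ℝ E]
  [MeasurableSpace E] [BorelSpace E]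
variable {F' : Type*} [NormedAddCommGroup F']
variable {t : ℕ → ℝ} {T₀ : ℝ}

omit [InnerProductSpace ℝ E] [FiniteDimensional ℝ E] [MeasurableSpace E] [BorelSpace E] in
/-- Positive times are covered by the strips and the tail:
`(0, ∞) × E ⊆ (⋃ⱼ [t_j, t_{j+1}) × E) ∪ [T₀, ∞) × E` (`t₀ = 0`, `t_j → T₀`). [folklore] -/
theorem Ioi_prod_subset_iUnion_strip_union [NormedSpace ℝ E] (h0 : t 0 = 0)
    (htend : Tendsto t atTop (𝓝 T₀)) :
    Ioi (0 : ℝ) ×ˢ (univ : Set E) ⊆ (⋃ j, Ico (t j) (t (j + 1)) ×ˢ (univ : Set E)) ∪ Ici T₀ ×ˢ univ := by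
  rintro ⟨s, x⟩ ⟨hs, -⟩
  rcases time_trichotomy h0 htend s with h | ⟨j, hj⟩ | h
  · exact absurd (mem_Ioi.1 hs) (not_lt.2 h)
  · exact Or.inl (mem_iUnion.2 ⟨j, hj, mem_univ _⟩)
  · exact Or.inr ⟨h, mem_univ _⟩

/-- **Space–time measurability of glued fields.** If `W` agrees on each half-open strip
`[t_j, t_{j+1}) × E` with a field continuous on the closed strip `[t_j, t_{j+1}] × E` and vanishes
from `T₀` on, then `W` is a.e. strongly measurable on `(0, ∞) × E` (`t₀ = 0`, `t_j → T₀`). [folklore] -/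
theorem aestronglyMeasurable_glue (h0 : t 0 = 0) (htend : Tendsto t atTop (𝓝 T₀))
    {W : ℝ × E → F'} {Wj : ℕ → ℝ × E → F'}
    (hcont : ∀ j, ContinuousOn (Wj j) (Icc (t j) (t (j + 1)) ×ˢ univ))
    (heq : ∀ j, EqOn W (Wj j) (Ico (t j) (t (j + 1)) ×ˢ univ))
    (hzero : ∀ z : ℝ × E, T₀ ≤ z.1 → W z = 0) :
    AEStronglyMeasurable W ((volume : Measure (ℝ × E)).restrict (Ioi 0 ×ˢ univ)) := by
  have hmeasA : AEStronglyMeasurable W ((volume : Measure (ℝ × E)).restrict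
      ((⋃ j, Ico (t j) (t (j + 1)) ×ˢ (univ : Set E)) ∪ Ici T₀ ×ˢ univ)) := by
    rw [aestronglyMeasurable_union_iff, aestronglyMeasurable_iUnion_iff]
    refine ⟨fun j => ?_, ?_⟩
    · have hS : MeasurableSet (Ico (t j) (t (j + 1)) ×ˢ (univ : Set E)) := measurableSet_strip j
      have h1 : AEStronglyMeasurable (Wj j)
          ((volume : Measure (ℝ × E)).restrict (Ico (t j) (t (j + 1)) ×ˢ univ)) :=
        ((hcont j).mono (prod_mono Ico_subset_Icc_self Subset.rfl)).aestronglyMeasurable hS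
      exact h1.congr ((ae_restrict_mem hS).mono fun z hz => (heq j hz).symm)
    · have hS : MeasurableSet (Ici T₀ ×ˢ (univ : Set E)) := measurableSet_Ici.prod MeasurableSet.univ
      refine (aestronglyMeasurable_const (b := (0 : F'))).congr ?_
      exact (ae_restrict_mem hS).mono fun z hz => (hzero z hz.1).symm
  exact hmeasA.mono_measure (Measure.restrict_mono (Ioi_prod_subset_iUnion_strip_union h0 htend) le_rfl)

/-- **Lower space–time integrals of glued fields are bounded by the sum over the strips**:
for `W ≥ 0` vanishing from `T₀` on, `∫∫_{(0,∞)×E} W ≤ Σⱼ ∫∫_{[t_j,t_{j+1})×E} W`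
(`t₀ = 0`, `t_j → T₀`). [folklore] -/
theorem setLIntegral_Ioi_prod_le_tsum (h0 : t 0 = 0) (htend : Tendsto t atTop (𝓝 T₀))
    {W : ℝ × E → ENNReal} (hzero : ∀ z : ℝ × E, T₀ ≤ z.1 → W z = 0) :
    ∫⁻ z in Ioi 0 ×ˢ univ, W z ≤ ∑' j, ∫⁻ z in Ico (t j) (t (j + 1)) ×ˢ univ, W z := by
  have htail : ∫⁻ z in Ici T₀ ×ˢ (univ : Set E), W z = 0 :=
    setLIntegral_eq_zero (measurableSet_Ici.prod MeasurableSet.univ) fun z hz => hzero z hz.1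
  calc ∫⁻ z in Ioi 0 ×ˢ univ, W z
      ≤ ∫⁻ z in (⋃ j, Ico (t j) (t (j + 1)) ×ˢ (univ : Set E)) ∪ Ici T₀ ×ˢ univ, W z :=
        lintegral_mono_set (Ioi_prod_subset_iUnion_strip_union h0 htend)
    _ ≤ (∫⁻ z in ⋃ j, Ico (t j) (t (j + 1)) ×ˢ (univ : Set E), W z) +
          ∫⁻ z in Ici T₀ ×ˢ (univ : Set E), W z := lintegral_union_le _ _ _
    _ ≤ ∑' j, ∫⁻ z in Ico (t j) (t (j + 1)) ×ˢ univ, W z := by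
        rw [htail, add_zero]
        exact lintegral_iUnion_le _ _

/-- Lower integrals over the strips `[a, b) × E` and `(a, b) × E` coincide (the line `{a} × E` is
null; `Ico_prod_ae_eq_Ioo_prod`). [folklore] -/
theorem setLIntegral_Ico_prod_eq_Ioo_prod (a b : ℝ) (W : ℝ × E → ENNReal) :
    ∫⁻ z in Ico a b ×ˢ (univ : Set E), W z = ∫⁻ z in Ioo a b ×ˢ (univ : Set E), W z :=
  setLIntegral_congr (Ico_prod_ae_eq_Ioo_prod a b)

/-- **Lower integrals over a strip as iterated integrals** (Tonelli):
`∫∫_{(a,b)×E} W = ∫_{(a,b)} ∫_E W` for `W` a.e.-measurable on the strip. [folklore] -/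
theorem setLIntegral_Ioo_prod_eq_lintegral_lintegral {a b : ℝ} {W : ℝ × E → ENNReal}
    (hW : AEMeasurable W (((volume : Measure ℝ).restrict (Ioo a b)).prod (volume : Measure E))) :
    ∫⁻ z in Ioo a b ×ˢ (univ : Set E), W z = ∫⁻ s in Ioo a b, ∫⁻ x, W (s, x) := by
  rw [Measure.volume_eq_prod, ← Measure.restrict_prod_eq_prod_univ, lintegral_prod _ hW]

end SpaceTime

end Literature.Barriers.NavierStokesRegularity

end
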